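/-
COR-CM (cell pub-hodgecm2) — ¬hJ RUSH, sub-lemma M2a′ (LEAD census v3 §5.2, pen nothj-p3): THE FULL SEPARATION `hsep` (`s = t`) of the admissible
triples of [Liu2021, Prop. 4.13]'s datum at the model's μ-uniform Weil carriers `Model.uniformOmegaRep … (2δ_F)⁻¹ (fun _ _ => r)`, DERIVED IN KERNEL from
[App. D Lem. D.1 (1), (3)] AS PRINTED per place — the END rows `hD1''` (pair form) and `hD3` (indexed family) — WITHOUT [Thm. 4.18 (2)] (no `hLiu418`).
The μ-component is ✔ `MuKeyIdentLemD3End.mu_eq_of_areIsomorphic_uniformOmegaRep_of_lemD1_3AsPrintedI` (mukey-p4, `ClosedPrintedMuKeyIdentLemD3.lean` §1);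
the ε- and χ-components are ✔ `Def411WeilCarriers.locF_eq_and_chi_eq_of_equiv_of_lemD1AsPrintedI` (`Literature/…/Liu2021/Def411WeilCarriersTripleSeparation.lean`).
This is the `hsep` ∕ `hdist` binder of ✔ `Prop413Data.rank_intertwiningMap_rhoAt_le_one_of_asPrinted` (multiplicity one), of
`Prop413Data.HodgeSplitting.isPure_of_asPrinted` (purity), and of the hodge-blind HEAD `not_hJ0_of_hodgeBlind_rows` (h21 ∕ h411 ∕ h413 ∕ hD3 ∕ hμsep).
THEOREMS ONLY; binder list = the μ-closer's VERBATIM; no `def`, no instance, no named-fact hypothesis, no `sorry`.  FRAMING: HC_CM is NOT proved;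
nothing here asserts hJ, hJ₀ or their negations.  Seat prover-pub-hodgecm2-nothj-p3-g0-0, 2026-08-24.
-/
import Summits.HodgeConjecture.CorCM.D2Bridge.ClosedPrintedMuKeyIdentLemD3
import Literature.NumberTheory.Automorphic.Liu2021.Def411WeilCarriersTripleSeparation
import HarnessLib

/-!
# `hsep` in full (`s = t`) at `uniformOmegaRep … (2δ_F)⁻¹ r` from [Liu2021, App. D Lem. D.1 (1), (3)] AS PRINTED per place

[Liu2021] Y. Liu, *Fourier–Jacobi cycles and arithmetic relative trace formula*, Camb. J. Math. **9** (2021) = arXiv:2102.11518, `FJcycle.tex`: Thm. 4.18 (2)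
«The `ℂ[𝔾(𝔸_F^∞)]`-modules in the direct sum … are mutually non-isomorphic» (l. 2241) is proved there by «Statement (2) follows from Lemma D.1» (l. 2270):
through «`ω(μ,ε,χ) := ⊗'_v ω(μ_v,ε_v,χ_v)`» (Def. 4.11, l. 2092–2096) an isomorphism `ω_s ≃ ω_t` restricts at every finite place to an isomorphism of the
local oscillator representations, and the LOCAL Lemma D.1 (3) (l. 5233) reads off `(μ_{s,v}, ε_{s,v}, χ_{s,v}) = (μ_{t,v}, ε_{t,v}, χ_{t,v})`; an idèle class
character, a collection `(ε_v)_v` and an automorphic character of `E¹∖(𝔸_E^∞)¹` are determined by their local components.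

* §1 `admTriple_eq_of_areIsomorphic_uniformOmegaRep_of_lemD1_3AsPrintedI` — the binder list of the μ-closer VERBATIM (`h, F, h6, ι₁, V, Φ, e, dV, hdV, hdV0,
  ιV, r, hn, H, hιV`, the displayed `hD1R` (= the END row `hD1''` at one scalar) and `hD3`, the two admissible triples `s t` with `ω_s ≠ 0` and a
  `𝔾(𝔸_F^∞)`-equivariant `ℂ`-linear `ω_s ≃ ω_t`), conclusion `s = t`.

HC_CM is NOT proved; HELD — WORLD = C FINAL.
-/

set_option autoImplicit false

noncomputable section

open scoped TensorProduct Matrix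

namespace Summit.HodgeConjecture.CorCM.D2Bridge.NotHJ

open NumberField NumberField.InfinitePlace
open HodgeCM.Model HodgeCM.Model.LiuIndex HodgeCM.Model.TowerCarrier
open Summit.HodgeConjecture.CorCM.Model
open Literature.AlgebraicGeometry.Motives (CMType)
open Literature.AlgebraicGeometry.HodgeTheory Literature.NumberTheory.Automorphic.PicardCM
open Literature.AlgebraicGeometry.ShimuraVarieties.UnitaryCanonicalModel
open Literature.NumberTheory.ComplexMultiplication
open Literature.NumberTheory.Automorphic
open Literature.NumberTheory.Automorphic.IdeleClassGroup (toHeckeCharacter isUnitary_toHeckeCharacter galConj)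
open Literature.NumberTheory.Automorphic.Liu2021 Literature.NumberTheory.Automorphic.Liu2021.AppendixC
open Literature.NumberTheory.Automorphic.Liu2021.AppendixC.RestOne
open Literature.NumberTheory.Automorphic.Liu2021.Def411WeilCarriers (lineOf locF Rep)
open Summit.HodgeConjecture.CorCM.Transposition.OmegaTransport (realUnit)
open HodgeCM.Model.ArchSideTerm (e₁)
open Literature.NumberTheory.GelbartRogawski1991 Literature.NumberTheory.GelbartRogawski1991.UnitaryDualPair
open Literature.NumberTheory.GelbartRogawski1991.UnitaryDualPair.LocalSplitting (localMu norm_localMu continuous_localMu localMu_toLocalRing_eq_one_iff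
  eq_of_forall_localMu_toHeckeCharacter_eq)
open Literature.RepresentationTheory Literature.RepresentationTheory.Liu2021
open Summit.HodgeConjecture.CorCM.Transposition
open Summit.HodgeConjecture.CorCM.D2Bridge.MuKeyIdentLemD3End (mu_eq_of_areIsomorphic_uniformOmegaRep_of_lemD1_3AsPrintedI)

/-! ## §1 The full separation at `Model.uniformOmegaRep … (2δ_F)⁻¹ (fun _ _ => r)` -/

/-- **`hsep` IN FULL at `Model.uniformOmegaRep h F ι₁ V Φ e dV hdV hdV0 ιV (2δ_F)⁻¹ (fun _ _ => r)` from [Liu2021, App. D Lem. D.1 (1), (3)] AS PRINTED per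
place** («Statement (2) follows from Lemma D.1», l. 2270) — the μ-closer's binder list VERBATIM (`hD1R` = the END row `hD1''` at one scalar, `hD3` = Lem. D.1 (3)
read on the indexed family `localIndexedFamilyAtV` of the tree's local data of those same `(μ, hμ, hw, j)`): two admissible triples `s, t` of [Prop. 4.13]'s datum
`U.prop413Data H` with `ω_s ≠ 0` and a `𝔾(𝔸_F^∞)`-equivariant `ℂ`-linear `ω_s ≃ ω_t` are EQUAL.  `μ`: ✔ the μ-closer; `ε`, `χ`: the same restriction step
[Flath Thm 3] with Lem. D.1 (3)'s class- and χ-clauses, globalised by ✔ `locF_eq_and_chi_eq_of_equiv_of_lemD1AsPrintedI` (collections are global and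
recovered by `r`, `Rep.locF_toFun`; `χ = ∏_v χ_v`).  Nothing of [Liu2021] is asserted.
[cite: Liu2021, Def. 4.11 (ll. 2083–2097), Def. 4.12 (ll. 2102–2108), Prop. 4.13 (ll. 2113–2119), Thm. 4.18 (2) with proof l. 2270, App. D Lemma D.1 (1), (3) (l. 5229, 5233)]
[cite: FlathCorvallis1979, Theorem 3 (uniqueness clause)] [cite: CasselsFrohlichANT1967, Ch. II §11 and Ch. VII §8] [cite: TateThesis1967, §3.2 Lemma 3.2.1] -/
theorem admTriple_eq_of_areIsomorphic_uniformOmegaRep_of_lemD1_3AsPrintedI (h : exists_recordSystem) (F : CMField) [IsGalois ℚ F]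
    (h6 : 6 ≤ Module.finrank ℚ F) (ι₁ : F →+* ℂ) (V : HermSpace3 F ι₁) (Φ : CMType F) {n : ℕ} (e : Fin 3 × Fin 1 ≃ Fin n) (dV : Fin 3 → F)
    (hdV : ∀ i, IsCMField.complexConj F (dV i) = dV i) (hdV0 : ∀ i, dV i ≠ 0)
    (ιV : (sec42DataOf h isoOf F ι₁ V Φ).G →* UnitaryGroup.finAdelic ↥(maximalRealSubfield F) F (IsCMField.complexConj F) 3 (Matrix.diagonal dV))
    (r : Rep ↥(maximalRealSubfield F) (imagUnitSq F)) (hn : 3 ≤ n)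
    (H : Type) [AddCommGroup H] [Module ℂ H] [Module (MonoidAlgebra ℂ (sec42DataOf h isoOf F ι₁ V Φ).G) H]
    [IsScalarTower ℂ (MonoidAlgebra ℂ (sec42DataOf h isoOf F ι₁ V Φ).G) H]
    (hιV : Function.Surjective ιV)
    (hD1R : ∀ (μ : Literature.NumberTheory.Automorphic.IdeleClassGroup F →ₜ* Circle) (hμ : IdeleClassGroup.IsConjugateSymplectic F μ)
      (hw : IdeleClassGroup.HasWeight F μ 1) (j : (toThm418Data _ (restOfCharDeltaPrime h F h6 ι₁ V Φ e dV hdV hdV0 ιV r μ hμ hw)).AdmIndex) (v : IsDedekindDomain.HeightOneSpectrum (𝓞 ↥(maximalRealSubfield F))),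
      LemD1_1AsPrinted
        (Def411WeilCarriers.localLemD1Data ↥(maximalRealSubfield F) F (IsCMField.complexConj F) 3 e (Matrix.diagonal dV) (complexConj_imagUnit F) (imagUnit_ne_zero F) (imagUnit_mul_self F) (realDiagonal_isSymm F dV hdV) (isUnit_det_realDiagonal F dV hdV hdV0) (realDiagonal_map F dV hdV).symm (r.toFun j.1.1)
          (OmegaChiSplitting.chiLocalSplittingsD F e dV hdV hdV0 (toHeckeCharacter F μ) ((isOscillatorChar_toHeckeCharacter_iff μ).mpr hμ) (r.toFun j.1.1))
          hn (localMu F (toHeckeCharacter F μ)) (fun v x => norm_localMu F (toHeckeCharacter F μ) v (isUnitary_toHeckeCharacter F μ) x)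
          (continuous_localMu F (toHeckeCharacter F μ))
          (fun v t => localMu_toLocalRing_eq_one_iff F (toHeckeCharacter F μ) v ((isOscillatorChar_toHeckeCharacter_iff μ).mpr hμ) t)
          j.1.2.1
          (Def411WeilCarriers.norm_chi_eq_one ↥(maximalRealSubfield F) F (IsCMField.complexConj F) (Algebra.IsQuadraticExtension.finrank_eq_two ↥(maximalRealSubfield F) F)
            (UnitaryGroup.algEquiv_ne_one_of_apply_eq_neg ↥(maximalRealSubfield F) F (IsCMField.complexConj F) (complexConj_imagUnit F) (imagUnit_ne_zero F)) j.1.2)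
          j.1.2.2.1 v))
    (hD3 : ∀ v : IsDedekindDomain.HeightOneSpectrum (𝓞 ↥(maximalRealSubfield F)), LemD1_3AsPrintedI
      (Def411WeilCarriers.localIndexedFamilyAtV (ι := ((μw : {μ : Literature.NumberTheory.Automorphic.IdeleClassGroup F →ₜ* Circle // IdeleClassGroup.IsConjugateSymplectic F μ ∧ IdeleClassGroup.HasWeight F μ 1}) × (toThm418Data _ (restOfCharDeltaPrime h F h6 ι₁ V Φ e dV hdV hdV0 ιV r μw.1 μw.2.1 μw.2.2)).AdmIndex)) ↥(maximalRealSubfield F) F (IsCMField.complexConj F) 3 e (Matrix.diagonal dV) (complexConj_imagUnit F) (imagUnit_ne_zero F) (imagUnit_mul_self F) (realDiagonal_isSymm F dV hdV) (isUnit_det_realDiagonal F dV hdV hdV0) (realDiagonal_map F dV hdV).symm hn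
        (fun t => r.toFun t.2.1.1) (fun t => t.2.1.2)
        (fun t => OmegaChiSplitting.chiLocalSplittingsD F e dV hdV hdV0 (toHeckeCharacter F t.1.1) ((isOscillatorChar_toHeckeCharacter_iff t.1.1).mpr t.1.2.1) (r.toFun t.2.1.1))
        (fun t => localMu F (toHeckeCharacter F t.1.1))
        (fun t v x => norm_localMu F (toHeckeCharacter F t.1.1) v (isUnitary_toHeckeCharacter F t.1.1) x)
        (fun t => continuous_localMu F (toHeckeCharacter F t.1.1))
        (fun t v x => localMu_toLocalRing_eq_one_iff F (toHeckeCharacter F t.1.1) v ((isOscillatorChar_toHeckeCharacter_iff t.1.1).mpr t.1.2.1) x) v))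
    (s t : ((uniformOmegaRep h F ι₁ V Φ e dV hdV hdV0 ιV (2 * imagUnit F)⁻¹ (fun _ _ => r)).prop413Data H).AdmTriple)
    (hs : Nontrivial (((uniformOmegaRep h F ι₁ V Φ e dV hdV hdV0 ιV (2 * imagUnit F)⁻¹ (fun _ _ => r)).prop413Data H).omegaAt s))
    (hst : ∃ f : ((uniformOmegaRep h F ι₁ V Φ e dV hdV hdV0 ιV (2 * imagUnit F)⁻¹ (fun _ _ => r)).prop413Data H).omegaAt s ≃ₗ[ℂ] ((uniformOmegaRep h F ι₁ V Φ e dV hdV hdV0 ιV (2 * imagUnit F)⁻¹ (fun _ _ => r)).prop413Data H).omegaAt t,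
      ∀ (g : (sec42DataOf h isoOf F ι₁ V Φ).G) (v : ((uniformOmegaRep h F ι₁ V Φ e dV hdV hdV0 ιV (2 * imagUnit F)⁻¹ (fun _ _ => r)).prop413Data H).omegaAt s),
        f ((((uniformOmegaRep h F ι₁ V Φ e dV hdV hdV0 ιV (2 * imagUnit F)⁻¹ (fun _ _ => r)).prop413Data H).rhoAt s) g v) = (((uniformOmegaRep h F ι₁ V Φ e dV hdV hdV0 ιV (2 * imagUnit F)⁻¹ (fun _ _ => r)).prop413Data H).rhoAt t) g (f v)) :
    s = t := by
  -- LIGHT internal index: the admissible triples of `U.prop413Data H` themselves; the DISPLAYED family (indexed by Σ (μ, hμ, hw, j) of the rest) is read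
  -- on them along `t ↦ (⟨μ_t, _⟩, ⟨(ε_t, χ_t), _⟩)` by ✔ `LemD1_3AsPrintedI.comap` (an admissible triple IS an admissible index of the rest at its own μ —
  -- ✔ `UniformOmega.admTripleOfRest` read backwards; `restOfCharDeltaPrime = U.rest (restTailOne …)`, ✔ `restOfCharRep_eq_rest`, `rfl`)
  -- (1) the `μ`-component: ✔ the 7-row μ-closer (restriction [Flath Thm 3], Lem. D.1 (3) μ-clause per place, weak approximation)
  have hμ := mu_eq_of_areIsomorphic_uniformOmegaRep_of_lemD1_3AsPrintedI h F h6 ι₁ V Φ e dV hdV hdV0 ιV r hn H hιV hD1R hD3 s t hs hst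
  -- (2) the `ε`- and `χ`-components: the SAME restriction step and the SAME displayed rows, Lem. D.1 (3)'s class- and χ-clauses per place,
  -- globalised by ✔ `Def411WeilCarriersTripleSeparation` (collections are tuples of local classes; `χ = ∏_v χ_v`), run on the LIGHT index as in (1)
  have key' := Def411WeilCarriers.locF_eq_and_chi_eq_of_equiv_of_lemD1AsPrintedI (ι := ((uniformOmegaRep h F ι₁ V Φ e dV hdV hdV0 ιV (2 * imagUnit F)⁻¹ (fun _ _ => r)).prop413Data H).AdmTriple) ↥(maximalRealSubfield F) F (IsCMField.complexConj F) 3 (Matrix.diagonal dV) (complexConj_imagUnit F) (imagUnit_ne_zero F) e (imagUnit_mul_self F) (realDiagonal_isSymm F dV hdV) (isUnit_det_realDiagonal F dV hdV hdV0) (realDiagonal_map F dV hdV).symm hn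
    (fun t => r.toFun t.1.ε) (fun t => t.1.χ)
    (fun t => OmegaChiSplitting.chiLocalSplittingsD F e dV hdV hdV0 (toHeckeCharacter F t.1.μ)
      ((isOscillatorChar_toHeckeCharacter_iff t.1.μ).mpr t.1.isConjugateSymplectic) (r.toFun t.1.ε))
    (fun t => localMu F (toHeckeCharacter F t.1.μ))
    (fun t v x => norm_localMu F (toHeckeCharacter F t.1.μ) v (isUnitary_toHeckeCharacter F t.1.μ) x)
    (fun t => continuous_localMu F (toHeckeCharacter F t.1.μ))
    (fun t v x => localMu_toLocalRing_eq_one_iff F (toHeckeCharacter F t.1.μ) v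
      ((isOscillatorChar_toHeckeCharacter_iff t.1.μ).mpr t.1.isConjugateSymplectic) x)
    (fun t a => OmegaChiSplitting.hsChiD F e dV hdV hdV0 (toHeckeCharacter F t.1.μ) (isUnitary_toHeckeCharacter F t.1.μ)
      ((isOscillatorChar_toHeckeCharacter_iff t.1.μ).mpr t.1.isConjugateSymplectic) a)
    (fun t => OmegaChiSplitting.hfac_sChiD F e dV hdV hdV0 (toHeckeCharacter F t.1.μ) (isUnitary_toHeckeCharacter F t.1.μ)
      ((isOscillatorChar_toHeckeCharacter_iff t.1.μ).mpr t.1.isConjugateSymplectic) (r.toFun t.1.ε))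
    (fun t v => hD1R t.1.μ t.1.isConjugateSymplectic t.2.1 ⟨(t.1.ε, t.1.χ), t.2.2⟩ v)
    (fun v => by
      -- the displayed Σ-indexed family READ ON the triples (✔ `LemD1_3AsPrintedI.comap`), both families unfolded to their fields (`dsimp`: δ of the two
      -- family constructors + β∕ι only; no rewriting lemma) so that the member-wise identity is syntactic
      have h3 := (hD3 v).comap fun t : ((uniformOmegaRep h F ι₁ V Φ e dV hdV hdV0 ιV (2 * imagUnit F)⁻¹ (fun _ _ => r)).prop413Data H).AdmTriple =>
        (⟨⟨t.1.μ, t.1.isConjugateSymplectic, t.2.1⟩, ⟨(t.1.ε, t.1.χ), t.2.2⟩⟩ : ((μw : {μ : Literature.NumberTheory.Automorphic.IdeleClassGroup F →ₜ* Circle // IdeleClassGroup.IsConjugateSymplectic F μ ∧ IdeleClassGroup.HasWeight F μ 1}) × (toThm418Data _ (restOfCharDeltaPrime h F h6 ι₁ V Φ e dV hdV hdV0 ιV r μw.1 μw.2.1 μw.2.2)).AdmIndex))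
      dsimp only [LemD1IndexedFamily.comap, Def411WeilCarriers.localIndexedFamilyAtV] at h3 ⊢
      exact h3)
    hιV s t hs hst
  -- (3) the admissible `ε` of a triple is a GLOBAL collection, which the faithful section `r` recovers (`Rep.locF_toFun`)
  have hglob : ∀ u : ((uniformOmegaRep h F ι₁ V Φ e dV hdV hdV0 ιV (2 * imagUnit F)⁻¹ (fun _ _ => r)).prop413Data H).AdmTriple,
      ∃ a, Def411WeilCarriers.locF ↥(maximalRealSubfield F) (imagUnitSq F) a = u.1.ε := fun u => by
    obtain ⟨x, -, hx⟩ := u.2.2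
    obtain ⟨a, ha⟩ := Def411WeilCarriers.exists_locF_eq_epsOf ↥(maximalRealSubfield F) F (imagUnitSq F) (2 * imagUnit F)⁻¹ x
    exact ⟨a, ha.trans hx⟩
  have hε : s.1.ε = t.1.ε :=
    ((r.locF_toFun s.1.ε (hglob s)).symm.trans key'.1).trans (r.locF_toFun t.1.ε (hglob t))
  have hχ : s.1.χ = t.1.χ := key'.2
  -- (4) a triple is its three components (`isConjugateSymplectic` is a proposition)
  rcases s with ⟨⟨μs, hμs, εs, χs⟩, ps⟩
  rcases t with ⟨⟨μt, hμt, εt, χt⟩, pt⟩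
  simp only at hμ hε hχ
  subst hμ hε hχ
  rfl

end Summit.HodgeConjecture.CorCM.D2Bridge.NotHJ

end
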